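import Summits.CriticalPhenomena.PercolationContinuityZ3.Theorems.PercNearOneGluingNoHeavyLowerTailSahiOneStepFibreThresholdFive
import Mathlib.Algebra.BigOperators.Group.Finset.Powerset
import HarnessLib

/-!
# One-step scheme: Q-HARRIS `(3′)` for EVERY THRESHOLD FIRST SLOT, IN EVERY DIMENSION (the antipodal count `(3*)` for all `d`)

Support file (prover prim-ineq-prove-3 gen 17; `--supports stmt-CriticalPhenomena-4575`; memo
`run/shared/lean/prim/prim-ineq-prove-3/FINDING-G17-THRESHOLD-ALL.md` §1).  No definitions, no named facts, no sorries, no `native_decide`.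

Gen 16 (`…SahiOneStepFibreThresholdFive`) proved the two-copy fibre inequality `(3*)` — the antipodal sum
`Σ_{R ⊆ D} h(R)u(R)v(R)(1 + h(D∖R)) − h(R)u(D∖R)v(D∖R) − h(R)h(D∖R)u(R)v(D∖R) ≥ 0`, `h(X) = [s ≤ |X|]`, `u, v` nonnegative and
monotone — for `|D| ≤ 5` from twenty LP certificates.  Here it is proved for EVERY finite `D` and every `s` (`star_sum_nonneg`) by a
two-line induction on `|D|`:
* after re-indexing the middle term by `R ↦ D ∖ R` (`star_sum_eq_tilde`), peeling one coordinate `m` compares the antipodal coupling at `m`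
  with the two faces `m ∈ R, m ∈ D∖R`-agreeing (thresholds `s`, `s − 1` on `D ∖ {m}`); the difference is, context by context, a sum of two
  products of first differences of monotone quantities (`starCtx_le`), nonnegative UNLESS `|D| = 2s − 1`;
* in the critical dimension `|D| = 2s − 1` the sum collapses to `Σ_{|R| ≥ s} u v − Σ_{|R| ≤ s−1} u v`, the top half of an odd cube against
  its bottom half for the monotone weight `w = uv`, which is `≥ 0` by the weighted mirror inequality `mirror_sum_le`
  (`Σ_{|R| ≤ a} w ≤ Σ_{|R| ≥ |D|−a} w`, itself a one-coordinate induction).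
Consequences (`osMp_threshold_nonneg`, `osMp_threshold_nonneg_all`, `qharris_threshold`): **for every finite `ι`, every product measure,
every `F ⊆ ι` of ANY size, every `t`, `H = {ω | t ≤ #(F ∩ ω)}` and ALL increasing `A, B ⊆ 2^ι`:
`(1 + μH)·μ(H∩A∩B) ≥ μ(H)·μ(A∩B) + μ(H∩A)·μ(H∩B)`** — the `(3′)` half of the one-step hypotheses for every threshold slot
(majority of any size included).
-/

noncomputable section

namespace Summit.CriticalPhenomena.PercolationContinuityZ3.Theorems

namespace SahiOneStep

open MeasureTheory Finset
open Literature.Probability.Percolation (DeterminedBy determinedBy_iff determinedBy_univ)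
open Literature.Probability.LatticeModels (prodBernoulli)
open Literature.Probability.Percolation.DecisionTree (ind ind_of_mem ind_of_not_mem ind_nonneg)
open scoped Classical

variable {ι : Type*} [Fintype ι] [DecidableEq ι]

/-! ## The weighted mirror inequality -/

omit [Fintype ι] in
/-- **Weighted mirror inequality.** For a nonnegative monotone weight `w` on finite sets and `a + b = |D|`:
`Σ_{R ⊆ D, |R| ≤ a} w(R) ≤ Σ_{R ⊆ D, |R| ≥ b} w(R)` (the bottom `a + 1` levels of the cube `2^D` weigh at most as much as the mirror
top levels).  Proof by peeling one coordinate. [folklore; this work (weighted form by induction)] -/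
theorem mirror_sum_le (D : Finset ι) :
    ∀ (a b : ℕ) (w : Finset ι → ℝ), (∀ S T : Finset ι, S ⊆ T → w S ≤ w T) → (∀ S, 0 ≤ w S) → a + b = D.card →
      ∑ R ∈ D.powerset, (if R.card ≤ a then w R else 0) ≤ ∑ R ∈ D.powerset, (if b ≤ R.card then w R else 0) := by
  induction D using Finset.induction_on with
  | empty =>
    intro a b w hw hw0 hab
    rw [Finset.card_empty] at hab
    have hb : b = 0 := by omega
    subst hb
    simp only [Finset.powerset_empty, Finset.sum_singleton, Finset.card_empty, zero_le, if_true, le_refl]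
  | insert m D' hm ih =>
    intro a b w hw hw0 hab
    rw [Finset.card_insert_of_notMem hm] at hab
    -- the case `b = 0`: the right-hand side is the full sum
    by_cases hb0 : b = 0
    · subst hb0
      refine Finset.sum_le_sum fun R _ => ?_
      simp only [zero_le, if_true]
      split_ifs
      · exact le_refl _
      · exact hw0 R
    -- the case `a = 0`: only `R = ∅` on the left, and `R = D` is on the right
    by_cases ha0 : a = 0
    · subst ha0
      have hl : ∑ R ∈ (insert m D').powerset, (if R.card ≤ 0 then w R else 0) = w ∅ := by
        rw [Finset.sum_eq_single_of_mem ∅ (Finset.empty_mem_powerset _)]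
        · simp only [Finset.card_empty, le_refl, if_true]
        · intro R hR hne
          have : ¬ R.card ≤ 0 := fun h => hne (Finset.card_eq_zero.1 (Nat.le_zero.1 h))
          rw [if_neg this]
      have hr : w (insert m D') ≤ ∑ R ∈ (insert m D').powerset, (if b ≤ R.card then w R else 0) := by
        have hmem : insert m D' ∈ (insert m D').powerset := Finset.mem_powerset.2 (subset_refl _)
        have := Finset.single_le_sum (f := fun R => if b ≤ R.card then w R else 0)
          (fun R _ => by
            show 0 ≤ (if b ≤ R.card then w R else 0)
            split_ifs
            · exact hw0 R
            · exact le_refl _) hmem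
        have hcard : b ≤ (insert m D').card := by rw [Finset.card_insert_of_notMem hm]; omega
        simp only [hcard, if_true] at this
        exact this
      rw [hl]
      exact (hw ∅ (insert m D') (Finset.empty_subset _)).trans hr
    -- generic case `a, b ≥ 1`
    have ih1 := ih (a - 1) b w hw hw0 (by omega)
    have ih2 := ih a (b - 1) (fun R => w (insert m R))
      (fun S T hST => hw _ _ (Finset.insert_subset_insert m hST)) (fun S => hw0 _) (by omega)
    rw [Finset.sum_powerset_insert hm, Finset.sum_powerset_insert hm]
    -- pointwise rearrangement on the left
    have hL : ∑ R ∈ D'.powerset, (if R.card ≤ a then w R else 0) + ∑ R ∈ D'.powerset, (if (insert m R).card ≤ a then w (insert m R) else 0) ≤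
        ∑ R ∈ D'.powerset, (if R.card ≤ a - 1 then w R else 0) + ∑ R ∈ D'.powerset, (if (b - 1) ≤ R.card then w (insert m R) else 0) := by
      have step1 : ∑ R ∈ D'.powerset, (if R.card ≤ a then w R else 0) + ∑ R ∈ D'.powerset, (if (insert m R).card ≤ a then w (insert m R) else 0) ≤
          ∑ R ∈ D'.powerset, (if R.card ≤ a - 1 then w R else 0) + ∑ R ∈ D'.powerset, (if R.card ≤ a then w (insert m R) else 0) := by
        rw [← Finset.sum_add_distrib, ← Finset.sum_add_distrib]
        refine Finset.sum_le_sum fun R hR => ?_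
        have hmR : m ∉ R := fun h => hm (Finset.mem_powerset.1 hR h)
        rw [Finset.card_insert_of_notMem hmR]
        have hmono : w R ≤ w (insert m R) := hw _ _ (Finset.subset_insert m R)
        have h0 := hw0 R
        have h1 := hw0 (insert m R)
        by_cases h1a : R.card ≤ a - 1
        · have h2 : R.card ≤ a := by omega
          rw [if_pos h2, if_pos h1a, if_pos h2]
          split_ifs <;> linarith
        · by_cases h2 : R.card ≤ a
          · have h3 : ¬ R.card + 1 ≤ a := by omega
            rw [if_pos h2, if_neg h3, if_neg h1a, if_pos h2]
            linarith
          · have h3 : ¬ R.card + 1 ≤ a := by omega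
            rw [if_neg h2, if_neg h3, if_neg h1a, if_neg h2]
      have step2 : ∑ R ∈ D'.powerset, (if R.card ≤ a then w (insert m R) else 0) ≤
          ∑ R ∈ D'.powerset, (if (b - 1) ≤ R.card then w (insert m R) else 0) := ih2
      linarith
    have hR : ∑ R ∈ D'.powerset, (if (b - 1) ≤ R.card then w (insert m R) else 0) =
        ∑ R ∈ D'.powerset, (if b ≤ (insert m R).card then w (insert m R) else 0) := by
      refine Finset.sum_congr rfl fun R hR => ?_
      have hmR : m ∉ R := fun h => hm (Finset.mem_powerset.1 hR h)
      rw [Finset.card_insert_of_notMem hmR]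
      have : (b - 1 ≤ R.card) ↔ (b ≤ R.card + 1) := by omega
      simp only [this]
    linarith

/-! ## The context inequality (one coordinate, non-critical dimension) -/

set_option maxHeartbeats 400000 in
/-- **Context inequality.** With `a ≤ a'`, `b ≤ b'` in `{0,1}`, `(a = a' ∨ b = b')`, `0 ≤ u ≤ u'`, `0 ≤ x ≤ x'`, `0 ≤ y ≤ y'`:
the two `m`-agreeing summands are dominated by the two `m`-antipodal summands,
`[a u x − (1−a) b u x − a b u y] + [a'u'x' − (1−a') b' u'x' − a' b' u' y'] ≤ [a u x − (1−a) b' u x − a b' u y'] + [a'u'x' − (1−a') b u'x' − a' b u' y]`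
(the difference is `(b'−b)(1−a)(u'x' − u x) + (a'u' − a u)(b'y' − b y)`). [this work] -/
theorem starCtx_le (a a' b b' u u' x x' y y' : ℝ) (ha : a = 0 ∨ a = 1) (ha' : a' = 0 ∨ a' = 1) (hb : b = 0 ∨ b = 1)
    (hb' : b' = 0 ∨ b' = 1) (haa : a ≤ a') (hbb : b ≤ b') (hkey : a = a' ∨ b = b')
    (hu : 0 ≤ u) (huu : u ≤ u') (hx : 0 ≤ x) (hxx : x ≤ x') (hy : 0 ≤ y) (hyy : y ≤ y') :
    (a * u * x - (1 - a) * b * u * x - a * b * u * y) + (a' * u' * x' - (1 - a') * b' * u' * x' - a' * b' * u' * y') ≤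
      (a * u * x - (1 - a) * b' * u * x - a * b' * u * y') + (a' * u' * x' - (1 - a') * b * u' * x' - a' * b * u' * y) := by
  have hux : u * x ≤ u' * x' := mul_le_mul huu hxx hx (hu.trans huu)
  have huy : u * y' ≤ u' * y' := mul_le_mul_of_nonneg_right huu (hy.trans hyy)
  have huy2 : u' * y ≤ u' * y' := mul_le_mul_of_nonneg_left hyy (hu.trans huu)
  have h0ux : 0 ≤ u * x := mul_nonneg hu hx
  have h0uy : 0 ≤ u * y := mul_nonneg hu hy
  have hm1 : 0 ≤ (u' - u) * (y' - y) := mul_nonneg (sub_nonneg.2 huu) (sub_nonneg.2 hyy)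
  have hm2 : 0 ≤ u' * (y' - y) := mul_nonneg (hu.trans huu) (sub_nonneg.2 hyy)
  have hm3 : 0 ≤ (u' - u) * y' := mul_nonneg (sub_nonneg.2 huu) (hy.trans hyy)
  rcases ha with rfl | rfl <;> rcases ha' with rfl | rfl <;> rcases hb with rfl | rfl <;> rcases hb' with rfl | rfl <;>
    rcases hkey with hk | hk <;> nlinarith [hux, huy, huy2, h0ux, h0uy, hm1, hm2, hm3]

/-! ## Re-indexing by the complement -/

omit [Fintype ι] in
/-- `Σ_{R ⊆ D} f(D ∖ R) = Σ_{R ⊆ D} f(R)` (the complement is an involution of `2^D`). [folklore] -/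
theorem sum_powerset_sdiff_reindex (D : Finset ι) (f : Finset ι → ℝ) :
    ∑ R ∈ D.powerset, f (D \ R) = ∑ R ∈ D.powerset, f R := by
  refine Finset.sum_bij' (fun R _ => D \ R) (fun R _ => D \ R) ?_ ?_ ?_ ?_ ?_
  · intro R _; exact Finset.mem_powerset.mpr Finset.sdiff_subset
  · intro R _; exact Finset.mem_powerset.mpr Finset.sdiff_subset
  · intro R hR; exact Finset.sdiff_sdiff_eq_self (Finset.mem_powerset.mp hR)
  · intro R hR; exact Finset.sdiff_sdiff_eq_self (Finset.mem_powerset.mp hR)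
  · intro R _; rfl

/-! ## The re-indexed ("tilde") antipodal sum and the main induction -/

omit [Fintype ι] in
/-- For `R ⊆ D'` and `m ∉ D'`: `insert m D' ∖ R = insert m (D' ∖ R)`. [folklore] -/
theorem insert_sdiff_of_subset {D' R : Finset ι} {m : ι} (hm : m ∉ D') (hR : R ⊆ D') :
    insert m D' \ R = insert m (D' \ R) := by
  have hmR : m ∉ R := fun h => hm (hR h)
  ext i
  simp only [Finset.mem_sdiff, Finset.mem_insert]
  constructor
  · rintro ⟨h1 | h1, h2⟩
    · exact Or.inl h1
    · exact Or.inr ⟨h1, h2⟩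
  · rintro (rfl | ⟨h1, h2⟩)
    · exact ⟨Or.inl rfl, hmR⟩
    · exact ⟨Or.inr h1, h2⟩

omit [Fintype ι] in
/-- For `m ∉ D'`: `insert m D' ∖ insert m R = D' ∖ R`. [folklore] -/
theorem insert_sdiff_insert_of_notMem {D' R : Finset ι} {m : ι} (hm : m ∉ D') :
    insert m D' \ insert m R = D' \ R := by
  ext i
  simp only [Finset.mem_sdiff, Finset.mem_insert, not_or]
  constructor
  · rintro ⟨h1 | h1, h2, h3⟩
    · exact absurd h1 h2
    · exact ⟨h1, h3⟩
  · rintro ⟨h1, h3⟩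
    exact ⟨Or.inr h1, fun h => hm (h ▸ h1), h3⟩

omit [Fintype ι] in
/-- **The antipodal count `(3*)` in every dimension (re-indexed form).**  For every finite `D`, every `s`, and nonnegative monotone `u, v`:
`Σ_{R ⊆ D} [h(R)u(R)v(R) − (1 − h(R))h(D∖R)u(R)v(R) − h(R)h(D∖R)u(R)v(D∖R)] ≥ 0`, `h(X) = [s ≤ |X|]`.  Induction on `D`: one coordinate is
peeled by `starCtx_le` unless `|D| = 2s − 1`, where the sum is a mirror difference handled by `mirror_sum_le`. [this work] -/
theorem starTilde_sum_nonneg (D : Finset ι) :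
    ∀ (s : ℕ) (u v : Finset ι → ℝ), (∀ S T : Finset ι, S ⊆ T → u S ≤ u T) → (∀ S, 0 ≤ u S) →
      (∀ S T : Finset ι, S ⊆ T → v S ≤ v T) → (∀ S, 0 ≤ v S) →
      0 ≤ ∑ R ∈ D.powerset, ((if s ≤ R.card then (1 : ℝ) else 0) * u R * v R
          - (1 - (if s ≤ R.card then (1 : ℝ) else 0)) * (if s ≤ (D \ R).card then (1 : ℝ) else 0) * u R * v R
          - (if s ≤ R.card then (1 : ℝ) else 0) * (if s ≤ (D \ R).card then (1 : ℝ) else 0) * u R * v (D \ R)) := by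
  induction D using Finset.induction_on with
  | empty =>
    intro s u v hu hu0 hv hv0
    simp only [Finset.powerset_empty, Finset.sum_singleton, Finset.sdiff_self, Finset.card_empty, nonpos_iff_eq_zero]
    split_ifs <;> nlinarith [hu0 ∅, hv0 ∅]
  | insert m D' hm ih =>
    intro s u v hu hu0 hv hv0
    by_cases hc : D'.card + 2 = 2 * s
    · -- critical dimension |D| = 2s - 1: the sum is a mirror difference of the monotone weight w = u v
      have hs : 1 ≤ s := by omega
      have hD : (insert m D').card = 2 * s - 1 := by rw [Finset.card_insert_of_notMem hm]; omega
      have hw : ∀ S T : Finset ι, S ⊆ T → u S * v S ≤ u T * v T := fun S T h => mul_le_mul (hu S T h) (hv S T h) (hv0 S) (hu0 T)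
      have hw0 : ∀ S, 0 ≤ u S * v S := fun S => mul_nonneg (hu0 S) (hv0 S)
      have key := mirror_sum_le (insert m D') (s - 1) s (fun R => u R * v R) hw hw0 (by omega)
      have hpt : ∀ R ∈ (insert m D').powerset,
          ((if s ≤ R.card then (1 : ℝ) else 0) * u R * v R
            - (1 - (if s ≤ R.card then (1 : ℝ) else 0)) * (if s ≤ ((insert m D') \ R).card then (1 : ℝ) else 0) * u R * v R
            - (if s ≤ R.card then (1 : ℝ) else 0) * (if s ≤ ((insert m D') \ R).card then (1 : ℝ) else 0) * u R * v ((insert m D') \ R)) =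
          (if s ≤ R.card then u R * v R else 0) - (if R.card ≤ s - 1 then u R * v R else 0) := by
        intro R hR
        have hsub := Finset.mem_powerset.1 hR
        have hcs : ((insert m D') \ R).card = (insert m D').card - R.card := Finset.card_sdiff_of_subset hsub
        have hRle : R.card ≤ (insert m D').card := Finset.card_le_card hsub
        rw [hD] at hcs hRle
        by_cases h1 : s ≤ R.card
        · have h2 : ¬ s ≤ ((insert m D') \ R).card := by rw [hcs]; omega
          have h3 : ¬ R.card ≤ s - 1 := by omega
          simp only [if_pos h1, if_neg h2, if_neg h3]; ring
        · have h2 : s ≤ ((insert m D') \ R).card := by rw [hcs]; omega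
          have h3 : R.card ≤ s - 1 := by omega
          simp only [if_neg h1, if_pos h2, if_pos h3]; ring
      rw [Finset.sum_congr rfl hpt, Finset.sum_sub_distrib]
      linarith
    · -- non-critical: peel the coordinate m
      have ih0 := ih s u v hu hu0 hv hv0
      have ih1 := ih (s - 1) (fun R => u (insert m R)) (fun R => v (insert m R))
        (fun S T h => hu _ _ (Finset.insert_subset_insert m h)) (fun S => hu0 _)
        (fun S T h => hv _ _ (Finset.insert_subset_insert m h)) (fun S => hv0 _)
      rw [Finset.sum_powerset_insert hm]
      -- rewrite both pieces context by context and compare with the two faces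
      have hmain : ∑ R ∈ D'.powerset, ((if (s - 1) ≤ R.card then (1 : ℝ) else 0) * u (insert m R) * v (insert m R)
            - (1 - (if (s - 1) ≤ R.card then (1 : ℝ) else 0)) * (if (s - 1) ≤ (D' \ R).card then (1 : ℝ) else 0) * u (insert m R) * v (insert m R)
            - (if (s - 1) ≤ R.card then (1 : ℝ) else 0) * (if (s - 1) ≤ (D' \ R).card then (1 : ℝ) else 0) * u (insert m R) * v (insert m (D' \ R)))
          + ∑ R ∈ D'.powerset, ((if s ≤ R.card then (1 : ℝ) else 0) * u R * v R
            - (1 - (if s ≤ R.card then (1 : ℝ) else 0)) * (if s ≤ (D' \ R).card then (1 : ℝ) else 0) * u R * v R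
            - (if s ≤ R.card then (1 : ℝ) else 0) * (if s ≤ (D' \ R).card then (1 : ℝ) else 0) * u R * v (D' \ R)) ≤
          ∑ R ∈ D'.powerset, ((if s ≤ R.card then (1 : ℝ) else 0) * u R * v R
            - (1 - (if s ≤ R.card then (1 : ℝ) else 0)) * (if s ≤ ((insert m D') \ R).card then (1 : ℝ) else 0) * u R * v R
            - (if s ≤ R.card then (1 : ℝ) else 0) * (if s ≤ ((insert m D') \ R).card then (1 : ℝ) else 0) * u R * v ((insert m D') \ R))
          + ∑ R ∈ D'.powerset, ((if s ≤ (insert m R).card then (1 : ℝ) else 0) * u (insert m R) * v (insert m R)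
            - (1 - (if s ≤ (insert m R).card then (1 : ℝ) else 0)) * (if s ≤ ((insert m D') \ insert m R).card then (1 : ℝ) else 0) *
                u (insert m R) * v (insert m R)
            - (if s ≤ (insert m R).card then (1 : ℝ) else 0) * (if s ≤ ((insert m D') \ insert m R).card then (1 : ℝ) else 0) *
                u (insert m R) * v ((insert m D') \ insert m R)) := by
        rw [← Finset.sum_add_distrib, ← Finset.sum_add_distrib]
        refine Finset.sum_le_sum fun R hR => ?_
        have hsub := Finset.mem_powerset.1 hR
        have hmR : m ∉ R := fun h => hm (hsub h)
        have hmc : m ∉ D' \ R := fun h => hm (Finset.mem_sdiff.1 h).1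
        rw [insert_sdiff_of_subset hm hsub, insert_sdiff_insert_of_notMem hm, Finset.card_insert_of_notMem hmR,
          Finset.card_insert_of_notMem hmc]
        have e1 : (if s ≤ R.card + 1 then (1 : ℝ) else 0) = (if s - 1 ≤ R.card then (1 : ℝ) else 0) := by
          have : (s ≤ R.card + 1) ↔ (s - 1 ≤ R.card) := by omega
          simp only [this]
        have e2 : (if s ≤ (D' \ R).card + 1 then (1 : ℝ) else 0) = (if s - 1 ≤ (D' \ R).card then (1 : ℝ) else 0) := by
          have : (s ≤ (D' \ R).card + 1) ↔ (s - 1 ≤ (D' \ R).card) := by omega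
          simp only [this]
        rw [e1, e2]
        have hcard : R.card + (D' \ R).card = D'.card := by
          rw [Finset.card_sdiff_of_subset hsub]; have := Finset.card_le_card hsub; omega
        -- instantiate the context inequality
        have h01 : ∀ (P : Prop) [Decidable P], ((if P then (1 : ℝ) else 0) = 0 ∨ (if P then (1 : ℝ) else 0) = 1) := by
          intro P _; by_cases hP : P
          · exact Or.inr (if_pos hP)
          · exact Or.inl (if_neg hP)
        have haa : (if s ≤ R.card then (1 : ℝ) else 0) ≤ (if s - 1 ≤ R.card then (1 : ℝ) else 0) := by
          by_cases h : s ≤ R.card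
          · have h' : s - 1 ≤ R.card := by omega
            rw [if_pos h, if_pos h']
          · rw [if_neg h]; split_ifs <;> norm_num
        have hbb : (if s ≤ (D' \ R).card then (1 : ℝ) else 0) ≤ (if s - 1 ≤ (D' \ R).card then (1 : ℝ) else 0) := by
          by_cases h : s ≤ (D' \ R).card
          · have h' : s - 1 ≤ (D' \ R).card := by omega
            rw [if_pos h, if_pos h']
          · rw [if_neg h]; split_ifs <;> norm_num
        have hkey : (if s ≤ R.card then (1 : ℝ) else 0) = (if s - 1 ≤ R.card then (1 : ℝ) else 0) ∨
            (if s ≤ (D' \ R).card then (1 : ℝ) else 0) = (if s - 1 ≤ (D' \ R).card then (1 : ℝ) else 0) := by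
          by_cases h1 : R.card + 1 = s
          · right
            have h2 : ¬ ((D' \ R).card + 1 = s) := by omega
            have : (s ≤ (D' \ R).card) ↔ (s - 1 ≤ (D' \ R).card) := by omega
            simp only [this]
          · left
            have : (s ≤ R.card) ↔ (s - 1 ≤ R.card) := by omega
            simp only [this]
        have := starCtx_le (if s ≤ R.card then (1 : ℝ) else 0) (if s - 1 ≤ R.card then (1 : ℝ) else 0)
          (if s ≤ (D' \ R).card then (1 : ℝ) else 0) (if s - 1 ≤ (D' \ R).card then (1 : ℝ) else 0)
          (u R) (u (insert m R)) (v R) (v (insert m R)) (v (D' \ R)) (v (insert m (D' \ R)))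
          (h01 _) (h01 _) (h01 _) (h01 _) haa hbb hkey
          (hu0 R) (hu _ _ (Finset.subset_insert m R)) (hv0 R) (hv _ _ (Finset.subset_insert m R))
          (hv0 _) (hv _ _ (Finset.subset_insert m _))
        linarith
      linarith

/-! ## Back to the literal form of `…FibreThresholdFive` -/

omit [Fintype ι] in
/-- The literal antipodal sum equals its re-indexed form (the middle term is re-indexed by `R ↦ D ∖ R`). [this work] -/
theorem star_sum_eq_tilde (D : Finset ι) (s : ℕ) (u v : Finset ι → ℝ) :
    ∑ R ∈ D.powerset, ((if s ≤ R.card then (1 : ℝ) else 0) * u R * v R * (1 + (if s ≤ (D \ R).card then (1 : ℝ) else 0))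
        - (if s ≤ R.card then (1 : ℝ) else 0) * u (D \ R) * v (D \ R)
        - (if s ≤ R.card then (1 : ℝ) else 0) * (if s ≤ (D \ R).card then (1 : ℝ) else 0) * u R * v (D \ R)) =
      ∑ R ∈ D.powerset, ((if s ≤ R.card then (1 : ℝ) else 0) * u R * v R
        - (1 - (if s ≤ R.card then (1 : ℝ) else 0)) * (if s ≤ (D \ R).card then (1 : ℝ) else 0) * u R * v R
        - (if s ≤ R.card then (1 : ℝ) else 0) * (if s ≤ (D \ R).card then (1 : ℝ) else 0) * u R * v (D \ R)) := by
  have hre := sum_powerset_sdiff_reindex D (fun R => (if s ≤ (D \ R).card then (1 : ℝ) else 0) * u R * v R)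
  have hre' : ∑ R ∈ D.powerset, (if s ≤ R.card then (1 : ℝ) else 0) * u (D \ R) * v (D \ R) =
      ∑ R ∈ D.powerset, (if s ≤ (D \ R).card then (1 : ℝ) else 0) * u R * v R := by
    rw [← hre]
    refine Finset.sum_congr rfl fun R hR => ?_
    rw [Finset.sdiff_sdiff_eq_self (Finset.mem_powerset.1 hR)]
  have hsplit : ∀ R ∈ D.powerset,
      ((if s ≤ R.card then (1 : ℝ) else 0) * u R * v R * (1 + (if s ≤ (D \ R).card then (1 : ℝ) else 0))
        - (if s ≤ R.card then (1 : ℝ) else 0) * u (D \ R) * v (D \ R)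
        - (if s ≤ R.card then (1 : ℝ) else 0) * (if s ≤ (D \ R).card then (1 : ℝ) else 0) * u R * v (D \ R)) =
      ((if s ≤ R.card then (1 : ℝ) else 0) * u R * v R
        - (1 - (if s ≤ R.card then (1 : ℝ) else 0)) * (if s ≤ (D \ R).card then (1 : ℝ) else 0) * u R * v R
        - (if s ≤ R.card then (1 : ℝ) else 0) * (if s ≤ (D \ R).card then (1 : ℝ) else 0) * u R * v (D \ R))
      + ((if s ≤ (D \ R).card then (1 : ℝ) else 0) * u R * v R - (if s ≤ R.card then (1 : ℝ) else 0) * u (D \ R) * v (D \ R)) := by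
    intro R _; ring
  have hzero : ∑ R ∈ D.powerset, ((if s ≤ (D \ R).card then (1 : ℝ) else 0) * u R * v R
      - (if s ≤ R.card then (1 : ℝ) else 0) * u (D \ R) * v (D \ R)) = 0 := by
    rw [Finset.sum_sub_distrib, hre', sub_self]
  rw [Finset.sum_congr rfl hsplit, Finset.sum_add_distrib, hzero, add_zero]

omit [Fintype ι] in
/-- **Antipodal sums with a threshold trace are nonnegative in EVERY dimension** (`…FibreThresholdFive.star_sum_nonneg_of_card_le_five`
without the restriction `|D| ≤ 5`). [this work] -/
theorem star_sum_nonneg (D : Finset ι) (s : ℕ) (u v : Finset ι → ℝ)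
    (hu : ∀ S T : Finset ι, S ⊆ T → u S ≤ u T) (hu0 : ∀ S, 0 ≤ u S)
    (hv : ∀ S T : Finset ι, S ⊆ T → v S ≤ v T) (hv0 : ∀ S, 0 ≤ v S) :
    0 ≤ ∑ R ∈ D.powerset, ((if s ≤ R.card then (1 : ℝ) else 0) * u R * v R * (1 + (if s ≤ (D \ R).card then (1 : ℝ) else 0))
        - (if s ≤ R.card then (1 : ℝ) else 0) * u (D \ R) * v (D \ R)
        - (if s ≤ R.card then (1 : ℝ) else 0) * (if s ≤ (D \ R).card then (1 : ℝ) else 0) * u R * v (D \ R)) := by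
  rw [star_sum_eq_tilde]
  exact starTilde_sum_nonneg D s u v hu hu0 hv hv0

/-! ## Assembly: Q-HARRIS for every threshold slot -/

/-- **`(3′)` for every threshold slot (any number of coordinates), F-determined pairs.** [this work] -/
theorem osMp_threshold_nonneg (p : ι → unitInterval) (F : Finset ι) (t : ℕ) {A B : Set (Set ι)}
    (hA : IsUpperSet A) (hB : IsUpperSet B) (hAF : DeterminedBy A (↑F : Set ι)) (hBF : DeterminedBy B (↑F : Set ι)) :
    0 ≤ osMp p {ω : Set ι | t ≤ (F.filter (· ∈ ω)).card} (ind A) (ind B) := by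
  refine osMp_ind_ind_nonneg_of_fibre2' p (determinedBy_threshold F t) hAF hBF fun I J hIJ hJF => ?_
  rw [Finset.sum_congr rfl fun R hR => phi2_threshold_eq F t A B hIJ hJF (Finset.mem_powerset.1 hR)]
  exact star_sum_nonneg (J \ I) (t - I.card) (fun X => ind (pat A) (I ∪ X)) (fun X => ind (pat B) (I ∪ X))
    (fun S T h => ind_pat_union_mono hA I h) (fun S => ind_nonneg _ _) (fun S T h => ind_pat_union_mono hB I h) (fun S => ind_nonneg _ _)

/-- **Q-HARRIS FOR EVERY THRESHOLD FIRST SLOT.**  For every finite `ι`, every product measure, every `F ⊆ ι` (any size), every `t`,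
`H = {ω | t ≤ #(F ∩ ω)}` and ALL increasing `A, B ⊆ 2^ι`:
`m′(H;A,B) = (1 + μH)·μ(H∩A∩B) − μ(H)·μ(A∩B) − μ(H∩A)·μ(H∩B) ≥ 0` — in particular for every majority slot `maj_{2r+1}`. [this work] -/
theorem osMp_threshold_nonneg_all (p : ι → unitInterval) (F : Finset ι) (t : ℕ) {A B : Set (Set ι)}
    (hA : IsUpperSet A) (hB : IsUpperSet B) :
    0 ≤ osMp p {ω : Set ι | t ≤ (F.filter (· ∈ ω)).card} (ind A) (ind B) :=
  osMp_nonneg_all_of_determined p (determinedBy_threshold F t)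
    (fun _ _ hA hB hAF hBF => osMp_threshold_nonneg p F t hA hB hAF hBF) hA hB

/-- The same in measure form: `μ(H∩A)·μ(H∩B) + μ(H)·μ(A∩B) ≤ (1 + μH)·μ(H∩A∩B)` for every threshold slot `H`, all increasing `A, B`.
[this work] -/
theorem qharris_threshold (p : ι → unitInterval) (F : Finset ι) (t : ℕ) {A B : Set (Set ι)}
    (hA : IsUpperSet A) (hB : IsUpperSet B) :
    (prodBernoulli p).real ({ω : Set ι | t ≤ (F.filter (· ∈ ω)).card} ∩ A) *
        (prodBernoulli p).real ({ω : Set ι | t ≤ (F.filter (· ∈ ω)).card} ∩ B)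
      + (prodBernoulli p).real {ω : Set ι | t ≤ (F.filter (· ∈ ω)).card} * (prodBernoulli p).real (A ∩ B) ≤
      (1 + (prodBernoulli p).real {ω : Set ι | t ≤ (F.filter (· ∈ ω)).card}) *
        (prodBernoulli p).real ({ω : Set ι | t ≤ (F.filter (· ∈ ω)).card} ∩ A ∩ B) := by
  have h := osMp_threshold_nonneg_all p F t hA hB
  rw [osMp_ind_ind] at h
  linarith

end SahiOneStep

end Summit.CriticalPhenomena.PercolationContinuityZ3.Theorems
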